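import Literature.Topology.FourManifolds.KirbyMovesFramedUniquenessProofs
import Literature.Topology.FourManifolds.DehnSurgeryUnknotZeroProofs
import Literature.Topology.FourManifolds.BlowDownModelSphere
import Literature.Topology.FourManifolds.FramedTubularNbhd
import Literature.Topology.FourManifolds.EquidimensionalEmbedding
import HarnessLib

/-!
# Comparison of multi-gluings, corestricted local diffeomorphisms, and `S² × S¹` as surgery with a prescribed tube

Infrastructure (theorems only) for the connected-sum decomposition of surgery on a split link
(`Literature.Topology.FourManifolds.exists_isSurgery_zeroFramedUnlink`, `KirbyCalculus.lean`):

* `exists_diffeomorph_comp_eq_of_multiGluings` — the comparison diffeomorphism between two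
  open multi-gluings (one copy of `A`, `ι` copies of `B`) of the same pieces along the same
  relations, *together with its defining equations* (the constructive content of the tree's
  `nonempty_diffeomorph_of_multiGluing`, `LinkSurgeryUniqueness.lean`; Kosinski,
  *Differential Manifolds* (1993), VI.1 and VI.6);
* `IsLocalDiffeomorphAt.codRestrict_opens` — the corestriction of a local diffeomorphism to an
  open submanifold containing its image is a local diffeomorphism;
* `exists_chart_of_flatChart` — a flattening chart of a knot defined on all of `ℝ³` with image
  in an open subset `U ⊆ 𝕊 3`, followed by an open smooth embedding `U ↪ Y`, is the inverse of a
  smooth chart of `Y` onto `ℝ³` (the chart `Φ` of the standard model `X # Sⁿ ≅ X`,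
  `ConnectedSumSphereData` of `ConnectedSumSphereIdentity.lean`);
* `exists_isOpenGluing_sphereTwoProdCircle` — **`S² × S¹` is `0`-surgery on the unknot with any
  prescribed oriented tubular neighbourhood of framing `0`**: the tree's presentation
  `isIntegralSurgery_unknot_zero_holds` (Rolfsen (1976), §9.G Example 3) transported along the
  diffeomorphism of `𝕊 3` furnished by the uniqueness of framed tubular neighbourhoods
  (`framedUniqueness_holds`, `KirbyMovesFramedUniquenessProofs.lean`; Kosinski (1993), III (3.5)).

## References

* A. Kosinski, *Differential Manifolds* (1993), Ch. III (3.5), Ch. VI §1, §6.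
* D. Rolfsen, *Knots and Links* (1976), §9.F, §9.G.
-/

open scoped Manifold ContDiff Topology
open Set Function Metric

noncomputable section

namespace Literature.Topology.FourManifolds

/-! ### The comparison diffeomorphism between two multi-gluings, with its equations -/

section MultiGluing

variable {EA HA EB HB EP HP EP' HP' : Type*}
  [NormedAddCommGroup EA] [NormedSpace ℝ EA] [TopologicalSpace HA] {IA : ModelWithCorners ℝ EA HA}
  [NormedAddCommGroup EB] [NormedSpace ℝ EB] [TopologicalSpace HB] {IB : ModelWithCorners ℝ EB HB}
  [NormedAddCommGroup EP] [NormedSpace ℝ EP] [TopologicalSpace HP] {IP : ModelWithCorners ℝ EP HP}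
  [NormedAddCommGroup EP'] [NormedSpace ℝ EP'] [TopologicalSpace HP']
  {IP' : ModelWithCorners ℝ EP' HP'}
  {ι A B P P' : Type*} [TopologicalSpace A] [ChartedSpace HA A] [TopologicalSpace B]
  [ChartedSpace HB B]
  [TopologicalSpace P] [ChartedSpace HP P] [TopologicalSpace P'] [ChartedSpace HP' P']
  {jA : A → P} {jB : ι → B → P} {jA' : A → P'} {jB' : ι → B → P'}

/-- **The comparison diffeomorphism between two open multi-gluings of the same pieces along the
same identifications, with its defining equations** `G ∘ jA = jA'`, `G ∘ jBᵢ = jB'ᵢ` (the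
constructive content of `nonempty_diffeomorph_of_multiGluing`; Kosinski (1993), VI.1, proof of
(1.1), several handles at once as in VI.6). [cite: Kosinski1993, Ch. VI §1, proof of Thm (1.1)] -/
theorem exists_diffeomorph_comp_eq_of_multiGluings [IsManifold IP ∞ P] [IsManifold IP' ∞ P']
    (hA : Manifold.IsSmoothEmbedding IA IP ∞ jA) (hAo : IsOpen (range jA))
    (hB : ∀ i, Manifold.IsSmoothEmbedding IB IP ∞ (jB i) ∧ IsOpen (range (jB i)))
    (hU : range jA ∪ ⋃ i, range (jB i) = univ)
    (hdisj : Pairwise fun i j ↦ Disjoint (range (jB i)) (range (jB j)))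
    (hA' : Manifold.IsSmoothEmbedding IA IP' ∞ jA') (hAo' : IsOpen (range jA'))
    (hB' : ∀ i, Manifold.IsSmoothEmbedding IB IP' ∞ (jB' i) ∧ IsOpen (range (jB' i)))
    (hU' : range jA' ∪ ⋃ i, range (jB' i) = univ)
    (hdisj' : Pairwise fun i j ↦ Disjoint (range (jB' i)) (range (jB' j)))
    (hR : ∀ i a b, jA a = jB i b ↔ jA' a = jB' i b) :
    ∃ G : P ≃ₘ⟮IP, IP'⟯ P', (∀ a, G (jA a) = jA' a) ∧ ∀ i b, G (jB i b) = jB' i b := by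
  obtain ⟨G, hGA, hGB⟩ := exists_multiGlueMap hU hA.isEmbedding.injective
    (fun i ↦ (hB i).1.isEmbedding.injective) hdisj fun i a b ↦ (hR i a b).1
  obtain ⟨G', hGA', hGB'⟩ := exists_multiGlueMap hU' hA'.isEmbedding.injective
    (fun i ↦ (hB' i).1.isEmbedding.injective) hdisj' fun i a b ↦ (hR i a b).2
  refine ⟨{ toFun := G
            invFun := G'
            left_inv := fun p ↦ ?_
            right_inv := fun p ↦ ?_
            contMDiff_toFun := contMDiff_multiGlueMap hA hAo hB hU hA'.contMDiff
              (fun i ↦ (hB' i).1.contMDiff) hGA hGB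
            contMDiff_invFun := contMDiff_multiGlueMap hA' hAo' hB' hU' hA.contMDiff
              (fun i ↦ (hB i).1.contMDiff) hGA' hGB' }, hGA, hGB⟩
  · rcases eq_univ_iff_forall.1 hU p with ⟨a, rfl⟩ | hp
    · rw [hGA, hGA']
    · obtain ⟨i, b, rfl⟩ : ∃ i b, jB i b = p := by simpa only [mem_iUnion, mem_range] using hp
      rw [hGB, hGB']
  · rcases eq_univ_iff_forall.1 hU' p with ⟨a, rfl⟩ | hp
    · rw [hGA', hGA]
    · obtain ⟨i, b, rfl⟩ : ∃ i b, jB' i b = p := by simpa only [mem_iUnion, mem_range] using hp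
      rw [hGB', hGB]

end MultiGluing

/-! ### Corestriction of local diffeomorphisms to open submanifolds -/

section Corestrict

variable {E H E' H' : Type*} [NormedAddCommGroup E] [NormedSpace ℝ E] [TopologicalSpace H]
  [NormedAddCommGroup E'] [NormedSpace ℝ E'] [TopologicalSpace H']
  {I : ModelWithCorners ℝ E H} {J : ModelWithCorners ℝ E' H'}
  {M : Type*} [TopologicalSpace M] [ChartedSpace H M]
  {N : Type*} [TopologicalSpace N] [ChartedSpace H' N]

/-- **The corestriction of a local diffeomorphism to an open submanifold containing its image is
a local diffeomorphism.** [folklore] -/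
theorem _root_.IsLocalDiffeomorphAt.codRestrict_opens {f : M → N} {x : M}
    (hf : IsLocalDiffeomorphAt I J ∞ f x) (U : TopologicalSpace.Opens N) (hU : ∀ y, f y ∈ U) :
    IsLocalDiffeomorphAt I J ∞ (fun y ↦ (⟨f y, hU y⟩ : U)) x := by
  obtain ⟨Φ, hx, heq⟩ := hf
  have hmapsto : ∀ y ∈ Φ.source, f y ∈ Φ.target := fun y hy ↦ by
    rw [heq hy]; exact Φ.map_source hy
  set Ψ : PartialDiffeomorph I J M U ∞ :=
    { toFun := fun y ↦ ⟨f y, hU y⟩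
      invFun := fun u ↦ Φ.toPartialEquiv.symm u
      source := Φ.source
      target := {u | (u : N) ∈ Φ.target}
      map_source' := fun y hy ↦ hmapsto y hy
      map_target' := fun u hu ↦ Φ.toPartialEquiv.map_target hu
      left_inv' := fun y hy ↦ by
        change Φ.toPartialEquiv.symm (f y) = y
        rw [heq hy]; exact Φ.toPartialEquiv.left_inv hy
      right_inv' := fun u hu ↦ by
        apply Subtype.ext
        change f (Φ.toPartialEquiv.symm u) = u
        rw [heq (Φ.toPartialEquiv.map_target hu)]; exact Φ.toPartialEquiv.right_inv hu
      open_source := Φ.open_source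
      open_target := Φ.open_target.preimage continuous_subtype_val
      contMDiffOn_toFun := by
        intro y hy
        refine (ContMDiffWithinAt.subtypeVal_comp_iff U _ _ _).1 ?_
        exact (Φ.contMDiffOn y hy).congr (fun z hz ↦ heq hz) (heq hy)
      contMDiffOn_invFun := Φ.contMDiffOn_invFun.comp contMDiff_subtype_val.contMDiffOn
        fun u hu ↦ hu } with hΨ
  exact ⟨Ψ, hx, fun y _ ↦ rfl⟩

/-- The corestriction of a local diffeomorphism (everywhere) to an open submanifold containing
its image is a local diffeomorphism. [folklore] -/
theorem _root_.IsLocalDiffeomorph.codRestrict_opens {f : M → N} (hf : IsLocalDiffeomorph I J ∞ f)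
    (U : TopologicalSpace.Opens N) (hU : ∀ y, f y ∈ U) :
    IsLocalDiffeomorph I J ∞ (fun y ↦ (⟨f y, hU y⟩ : U)) := fun x ↦
  (hf x).codRestrict_opens U hU

end Corestrict

/-! ### A chart of `Y` onto `ℝ³` from a global flattening chart followed by an open embedding -/

section Chart

/-- Local notation: `𝔼 n` is the model Euclidean space `EuclideanSpace ℝ (Fin n)`. -/
local notation "𝔼 " n:arg => EuclideanSpace ℝ (Fin n)

/-- Local notation: `𝕊 n` is the unit sphere in `EuclideanSpace ℝ (Fin (n + 1))`. -/
local notation "𝕊 " n:arg => (Metric.sphere (0 : EuclideanSpace ℝ (Fin (n + 1))) 1)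

/-- **The chart of the standard model from an embedded flattening chart.** Let `Φ` be a flattening
chart of a knot defined on all of `ℝ³` (`Φ.Ω = univ`) with image in the open set `U ⊆ 𝕊 3`, let
`j : U → Y` be a smooth embedding into a smooth `3`-manifold (equidimensional, hence open), and `c ≠ 0`. Then
`i : y ↦ j (Φ.Γ (c • y))` is an open smooth embedding `ℝ³ ↪ Y` and the inverse of a smooth chart
`e` of `Y` onto `ℝ³` (`e.target = univ`, `e` smooth on `e.source = range i`, `e.symm = i` smooth):
`i` is an injective local diffeomorphism (composition of a homothety, the local diffeomorphism
`Φ.Γ` corestricted to `U`, and `j`), hence an open smooth embedding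
(`isSmoothEmbedding_of_isLocalDiffeomorph`), whose inverse is smooth on the (open) range
(`contMDiffOn_symm_of_isSmoothEmbedding`). [folklore] -/
theorem exists_chart_of_flatChart {Y : Type*} [TopologicalSpace Y] [ChartedSpace (𝔼 3) Y]
    [IsManifold (𝓡 3) ∞ Y] {U : TopologicalSpace.Opens (𝕊 3)} {j : U → Y}
    (hj : Manifold.IsSmoothEmbedding (𝓡 3) (𝓡 3) ∞ j)
    {K : Knot} (Φ : K.FlatChart) (hΩ : Φ.Ω = univ) (hU : ∀ y, Φ.Γ y ∈ U) {c : ℝ} (hc : c ≠ 0) :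
    ∃ e : OpenPartialHomeomorph Y (𝔼 3), e.target = univ ∧
      ContMDiffOn (𝓡 3) (𝓡 3) ∞ e e.source ∧ ContMDiff (𝓡 3) (𝓡 3) ∞ e.symm ∧
      (∀ y, e.symm y = j ⟨Φ.Γ (c • y), hU _⟩) ∧
      e.source = range (fun y : 𝔼 3 ↦ j ⟨Φ.Γ (c • y), hU _⟩) ∧
      Manifold.IsSmoothEmbedding (𝓡 3) (𝓡 3) ∞ (fun y : 𝔼 3 ↦ j ⟨Φ.Γ (c • y), hU _⟩) := by
  set i : 𝔼 3 → Y := fun y ↦ j ⟨Φ.Γ (c • y), hU _⟩ with hi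
  -- the homothety
  set L : 𝔼 3 ≃L[ℝ] 𝔼 3 := ContinuousLinearEquiv.equivOfInverse
    (c • ContinuousLinearMap.id ℝ (𝔼 3)) (c⁻¹ • ContinuousLinearMap.id ℝ (𝔼 3))
    (fun y ↦ by
      change c⁻¹ • (c • y) = y
      rw [smul_smul, inv_mul_cancel₀ hc, one_smul])
    (fun y ↦ by
      change c • (c⁻¹ • y) = y
      rw [smul_smul, mul_inv_cancel₀ hc, one_smul])
    with hL
  have hLapp : ∀ y, L y = c • y := fun y ↦ rfl
  -- `i` is an injective local diffeomorphism
  have hjloc : IsLocalDiffeomorph (𝓡 3) (𝓡 3) ∞ j := hj.isLocalDiffeomorph_of_finrank_eq rfl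
  have hΓloc : IsLocalDiffeomorph 𝓘(ℝ, 𝔼 3) (𝓡 3) ∞ (fun y ↦ (⟨Φ.Γ (c • y), hU _⟩ : U)) := by
    intro y
    have h1 : IsLocalDiffeomorphAt 𝓘(ℝ, 𝔼 3) (𝓡 3) ∞ (Φ.Γ ∘ L) y :=
      IsLocalDiffeomorphAt.comp (hf := L.toDiffeomorph.isLocalDiffeomorph y)
        (hg := Φ.isLocalDiffeomorphAt _ (by rw [hΩ]; trivial))
    exact (h1.codRestrict_opens U fun z ↦ hU _ :)
  have hiloc : IsLocalDiffeomorph 𝓘(ℝ, 𝔼 3) (𝓡 3) ∞ i := fun y ↦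
    IsLocalDiffeomorphAt.comp (hf := hΓloc y) (hg := hjloc _)
  have hiinj : Injective i := by
    intro y y' h
    have h1 := hj.isEmbedding.injective h
    have h2 : Φ.Γ (c • y) = Φ.Γ (c • y') := congrArg Subtype.val h1
    have h3 := Φ.injOn (by rw [hΩ]; trivial) (by rw [hΩ]; trivial) h2
    exact smul_right_injective _ hc h3
  have hiemb : Manifold.IsSmoothEmbedding (𝓡 3) (𝓡 3) ∞ i :=
    isSmoothEmbedding_of_isLocalDiffeomorph hiloc hiinj (ContinuousLinearEquiv.refl ℝ _)
  have hio : Topology.IsOpenEmbedding i := ⟨hiemb.isEmbedding, hiloc.isOpen_range⟩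
  -- the chart
  haveI : Nonempty (𝔼 3) := ⟨0⟩
  set Ψ := hio.toOpenPartialHomeomorph i with hΨ
  have hΨi : ⇑Ψ = i := hio.toOpenPartialHomeomorph_apply i
  have hsrc : Ψ.source = univ := hio.toOpenPartialHomeomorph_source i
  have htgt : Ψ.target = range i := hio.toOpenPartialHomeomorph_target i
  have hΨsymm : ContMDiffOn (𝓡 3) (𝓡 3) ∞ Ψ.symm (range i) := contMDiffOn_symm_of_isSmoothEmbedding hiemb hio
  refine ⟨Ψ.symm, by rw [Ψ.symm_target, hsrc], ?_, ?_, fun y ↦ ?_, ?_, hiemb⟩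
  · rw [Ψ.symm_source, htgt]; exact hΨsymm
  · rw [Ψ.symm_symm, hΨi]; exact hiemb.contMDiff
  · rw [Ψ.symm_symm, hΨi]
  · rw [Ψ.symm_source, htgt]

end Chart

/-! ### `S² × S¹` is `0`-surgery on the unknot with any prescribed framing-`0` tube -/

section SphereTwoProdCircle

/-- Local notation: `𝔼 n` is the model Euclidean space `EuclideanSpace ℝ (Fin n)`. -/
local notation "𝔼 " n:arg => EuclideanSpace ℝ (Fin n)

/-- Local notation: `𝕊 n` is the unit sphere in `EuclideanSpace ℝ (Fin (n + 1))`. -/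
local notation "𝕊 " n:arg => (Metric.sphere (0 : EuclideanSpace ℝ (Fin (n + 1))) 1)

/-- **`S² × S¹` is `0`-surgery on the unknot, presented with any oriented tubular neighbourhood of
framing `0`.** For every oriented tubular neighbourhood `ν` of the standard unknot with
`ν.HasFraming 0`, the product `𝕊 2 × 𝕊 1` is the open gluing of the unknot complement and the
open solid torus along `surgeryRel ν`. Proof: the tree's explicit presentation
(`isIntegralSurgery_unknot_zero_holds`: a tube `ν₀` of framing `0` and gluing maps; Rolfsen
(1976), §9.G, Example 3) is transported along a diffeomorphism `φ` of `𝕊 3` fixing the unknot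
pointwise with `φ ∘ ν₀ = ν` on the open unit tube (`framedUniqueness_holds`, uniqueness of framed
tubular neighbourhoods, Kosinski (1993), III (3.5)): precompose the embedding of the complement
with `φ⁻¹`. [cite: Rolfsen1976, §9.G Example 3] -/
theorem exists_isOpenGluing_sphereTwoProdCircle (ν : Knot.TubularNbhd unknot) (hν : ν.HasFraming 0) :
    IsOpenGluing (𝓡 3) (𝓘(ℝ, 𝔼 2).prod (𝓡 1)) ((𝓡 2).prod (𝓡 1)) (A := (unknot).complement)
      (B := solidTorus) (P := (𝕊 2) × (𝕊 1)) (surgeryRel ν) := by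
  obtain ⟨ν₀, h₀, jA, jB, hA, hAo, hB, hBo, hcov, hrel⟩ := isIntegralSurgery_unknot_zero_holds
  -- normalise `ν₀` to `ν` by an ambient diffeomorphism fixing the unknot
  obtain ⟨φ, hK, -, hconj⟩ := Knot.TubularNbhd.framedUniqueness_holds ν₀ ν 0 h₀ hν univ isOpen_univ
    (subset_univ _)
    (subset_univ _)
  -- the restriction of `φ⁻¹` to the unknot complement
  have hmem : ∀ a : (unknot).complement, φ.symm a ∈ (unknot).complement := fun a ↦ by
    rw [SphereEmbedding.mem_complement_iff]
    rintro ⟨y, hy⟩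
    have := congrArg φ hy
    rw [Diffeomorph.apply_symm_apply, hK] at this
    exact (SphereEmbedding.mem_complement_iff unknot a).1 a.2 ⟨y, this⟩
  have hmem' : ∀ a : (unknot).complement, φ a ∈ (unknot).complement := fun a ↦ by
    rw [SphereEmbedding.mem_complement_iff]
    rintro ⟨y, hy⟩
    rw [← hK] at hy
    exact (SphereEmbedding.mem_complement_iff unknot a).1 a.2 ⟨y, φ.injective hy⟩
  set ψ : (unknot).complement ≃ₘ⟮𝓡 3, 𝓡 3⟯ (unknot).complement :=
    { toFun := fun a ↦ ⟨φ.symm a, hmem a⟩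
      invFun := fun a ↦ ⟨φ a, hmem' a⟩
      left_inv := fun a ↦ Subtype.ext (φ.apply_symm_apply _)
      right_inv := fun a ↦ Subtype.ext (φ.symm_apply_apply _)
      contMDiff_toFun := (ContMDiff.subtypeVal_comp_iff (unknot).complement _).1
        (φ.symm.contMDiff.comp contMDiff_subtype_val)
      contMDiff_invFun := (ContMDiff.subtypeVal_comp_iff (unknot).complement _).1
        (φ.contMDiff.comp contMDiff_subtype_val) } with hψ
  have hψapp : ∀ a : (unknot).complement, ((ψ a : (unknot).complement) : 𝕊 3) = φ.symm a :=
    fun a ↦ rfl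
  have hsurj : Surjective ψ := ψ.surjective
  refine ⟨jA ∘ ψ, jB, hA.comp_diffeomorph ψ, by rwa [hsurj.range_comp], hB, hBo,
    by rwa [hsurj.range_comp], fun a b ↦ ?_⟩
  rw [comp_apply, hrel]
  change ν₀.glueRel (φ.symm a) b ↔ ν.glueRel (a : 𝕊 3) b
  have hlt : ∀ {t : ℝ}, t ∈ Ioo (0 : ℝ) 1 → ∀ v : 𝕊 1, ‖t • (v : 𝔼 2)‖ < 1 := fun ht v ↦ by
    rw [norm_smul, norm_eq_of_mem_sphere v, mul_one, Real.norm_of_nonneg ht.1.le]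
    exact ht.2
  constructor
  · rintro ⟨u, t, ht, hb, ha⟩
    refine ⟨u, t, ht, hb, ?_⟩
    have := congrArg φ ha
    rwa [Diffeomorph.apply_symm_apply, hconj u _ (hlt ht _)] at this
  · rintro ⟨u, t, ht, hb, ha⟩
    refine ⟨u, t, ht, hb, ?_⟩
    rw [ha, ← hconj u _ (hlt ht _), Diffeomorph.symm_apply_apply]

end SphereTwoProdCircle

end Literature.Topology.FourManifolds
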